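import Literature.Probability.LatticeModels.RegularScales
import HarnessLib

/-!
# The two-site bounds (6.5) behind the concentration of `𝐍` (Aizenman–Duminil-Copin 2021, Prop. 6.6)

Topic `Literature/Probability/LatticeModels`. Definitions with bodies and theorems; **no named fact is
introduced** (D-0026).

M. Aizenman, H. Duminil-Copin, Ann. of Math. **194** (2021) = arXiv:1912.07973, §6.2, proof of
**Proposition 6.6** (concentration of `𝐍`, pp. 23–24): with `a_{x,y}(u) = ⟨σ_xσ_u⟩⟨σ_uσ_y⟩/⟨σ_xσ_y⟩`,
`A_{x,y}(2^k) = ∑_{u ∈ 𝔸_y(2^k)} a_{x,y}(u)` and a set `𝒦` of well separated regular scales, "it suffices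
to show that `E^{xy,∅}[𝐍ᵢ²] ≤ 1 + C₂/|𝒦|`, which follows from the inequality, for every `ℓ ≥ k` in `𝒦`,
(6.5) `∑_{u ∈ 𝔸_y(2^k), v ∈ 𝔸_y(2^ℓ)} P^{xy,∅}[u,v ↔ x] ≤ A_{x,y}(2^k)A_{x,y}(2^ℓ)(1 + C₃2^{-(ℓ-k)})`",
proved from the two-site switching bound (A.3)
`P^{xy,∅}[u,v ↔ x] ≤ (⟨σ_xσ_u⟩⟨σ_uσ_v⟩⟨σ_vσ_y⟩ + ⟨σ_xσ_v⟩⟨σ_vσ_u⟩⟨σ_uσ_y⟩)/⟨σ_xσ_y⟩` and the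
properties P1–P4 of regular scales: case `ℓ > k` by (b1) (P2 at the scale `ℓ`, and the defining
inequality of `𝔸_y`) and (b2) (P3 for the regular scales of `𝒦` between `k` and `ℓ`); case `ℓ = k` by P1,
P4 and the size of `𝔸_y(2^k)`.

This file is the deterministic real-analysis content of that proof, for a translation-invariant
two-point function `S : ℤ^d → ℝ` (centre `x = 0`, far source `y`), a finite set `𝒦` of scales and index
sets `I k ⊆ Ann(2^k, 2^{k+1})`; the hypotheses are exactly the inputs named above — positivity of `S`,
`(c,C)`-regularity of the scales of `𝒦` (`IsRegularScale`, Def. 5.11), their separation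
(`(C+2)2^k < 2^ℓ` for `k < ℓ` in `𝒦`), the size `#I_k ≥ γ 2^{dk}` and the DOMINATION inequality defining
`𝔸_y`: `S(y - x') ≤ (1 + κ 2^k/Y) S(y - u)` for `u ∈ I_k`, `x' ∈ Λ_{2^k/16}`, with `2^ℓ ≤ Y` on `𝒦`
(for `y` in a regular scale this is Remark 6.5 / `IsRegularScale.shift_le` with `I_k` the full annulus;
for an arbitrary far `y` it holds with `κ = 0` on the cube `FarPointGoodDirections.goodCube`):

* `switchCoeff S y u = S(u)S(y-u)/S(y)` (`a_{0,y}(u)`), `switchTotal S y I = ∑_{u∈I} a(u)` (`A`),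
  `twoSiteTerm S y v w = (S(w)S(v-w)S(y-v) + S(v)S(w-v)S(y-w))/S(y)` (the bound (A.3) on `P[v,w ↔ 0]`);
* `le_of_regularChain` — P3 iterated along the regular scales between `k` and `ℓ` ((b2));
* `sum_twoSiteTerm_offDiag_le` — **(6.5), `k < ℓ`**: `∑_{v∈I_k,w∈I_ℓ} t(v,w) ≤ A_kA_ℓ(1 + C″2^{-r})`,
  `r = #(𝒦 ∩ [k,ℓ))`;
* `sum_twoSiteTerm_diag_le` — **(6.5), `k = ℓ`**: `∑_{v,w∈I_k} t(v,w) ≤ C_Δ A_k²`;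
* `sum_inv_mul_sum_twoSiteTerm_le` — the normalised double sum over `𝒦 × 𝒦` is `≤ |𝒦|² + C_* |𝒦|`, i.e.
  "`E[𝐍ᵢ²] ≤ 1 + C₂/|𝒦|`" once divided by `|𝒦|²` (the form fed to `Current.mixingCore`, hypothesis `hB`).

## References

* M. Aizenman, H. Duminil-Copin, Ann. of Math. 194 (2021), arXiv:1912.07973, §6.2, proof of Prop. 6.6,
  (6.5) and (b0)–(b2), (aaas) (pp. 23–24); Def. 5.11 (regular scales, p. 20) [AizenmanDuminilCopinAnnals2021].
-/

noncomputable section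

open Finset

namespace Literature.Probability.LatticeModels

variable {d : ℕ}

/-! ### The quantities -/

/-- `a_{0,y}(u) = S(u)S(y-u)/S(y)` — "`a_{x,y}(u) := ⟨σ_xσ_u⟩⟨σ_uσ_y⟩/⟨σ_xσ_y⟩`" with `x = 0`.
[cite: AizenmanDuminilCopinAnnals2021, arXiv:1912.07973 §6.2, definition of 𝐍ᵢ (p. 23)] -/
def switchCoeff (S : Site d → ℝ) (y u : Site d) : ℝ := S u * S (y - u) / S y

/-- `A_{0,y}(I) = ∑_{u ∈ I} a_{0,y}(u)`. [cite: AizenmanDuminilCopinAnnals2021, arXiv:1912.07973 §6.2, definition of 𝐍ᵢ (p. 23)] -/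
def switchTotal (S : Site d → ℝ) (y : Site d) (I : Finset (Site d)) : ℝ := ∑ u ∈ I, switchCoeff S y u

/-- The two-site bound (A.3) on `P^{0y,∅}[v, w ↔ 0]`:
`t(v,w) = (S(w)S(v-w)S(y-v) + S(v)S(w-v)S(y-w))/S(y)`. [cite: AizenmanDuminilCopinAnnals2021, arXiv:1912.07973 §6.2, (b0) (p. 24) and Prop. A.3] -/
def twoSiteTerm (S : Site d → ℝ) (y v w : Site d) : ℝ :=
  (S w * S (v - w) * S (y - v) + S v * S (w - v) * S (y - w)) / S y

/-- `t(v,w) = t(w,v)`. [folklore] -/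
theorem twoSiteTerm_comm (S : Site d → ℝ) (y v w : Site d) : twoSiteTerm S y v w = twoSiteTerm S y w v := by
  unfold twoSiteTerm; ring

variable {S : Site d → ℝ}

/-- `a(u) > 0` for a positive `S`. [folklore] -/
theorem switchCoeff_pos (hS : ∀ x, 0 < S x) (y u : Site d) : 0 < switchCoeff S y u := by
  unfold switchCoeff; exact div_pos (mul_pos (hS _) (hS _)) (hS _)

/-- `A(I) ≥ 0`. [folklore] -/
theorem switchTotal_nonneg (hS : ∀ x, 0 < S x) (y : Site d) (I : Finset (Site d)) : 0 ≤ switchTotal S y I :=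
  Finset.sum_nonneg fun u _ => (switchCoeff_pos hS y u).le

/-- **The two-site term through the switch coefficients** ((b0)): for positive `S`,
`t(v,w) = a(v)a(w)·[S(v-w)S(y)/(S(v)S(y-w))] + a(v)a(w)·[S(w-v)S(y)/(S(w)S(y-v))]`.
[cite: AizenmanDuminilCopinAnnals2021, arXiv:1912.07973 §6.2, (b0) (p. 24)] -/
theorem twoSiteTerm_eq (hS : ∀ x, 0 < S x) (y v w : Site d) :
    twoSiteTerm S y v w =
      switchCoeff S y v * switchCoeff S y w * (S (v - w) * S y / (S v * S (y - w))) +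
        switchCoeff S y v * switchCoeff S y w * (S (w - v) * S y / (S w * S (y - v))) := by
  unfold twoSiteTerm switchCoeff
  have h1 := (hS y).ne'
  have h2 := (hS v).ne'
  have h3 := (hS w).ne'
  have h4 := (hS (y - v)).ne'
  have h5 := (hS (y - w)).ne'
  field_simp

/-! ### P3 along a chain of regular scales ((b2)) -/

/-- The axis point `2^j e_{i₀}` lies in `Λ_{2^j}`. [folklore] -/
theorem single_pow_mem_box (i₀ : Fin d) (j : ℕ) : (Pi.single i₀ ((2 : ℤ) ^ j) : Site d) ∈ box d (2 ^ j) := by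
  rw [mem_box_iff_supNorm_le, Site.supNorm_single, Int.natAbs_pow]
  simp

/-- The axis point `2^j e_{i₀}` has sup norm `2^j`. [folklore] -/
theorem supNorm_single_pow (i₀ : Fin d) (j : ℕ) : Site.supNorm (Pi.single i₀ ((2 : ℤ) ^ j) : Site d) = 2 ^ j := by
  rw [Site.supNorm_single, Int.natAbs_pow]
  simp

/-- **P3 iterated** ("Property P3 for the `ℓ-k` regular scales in `𝒦` between `k` and `ℓ`"): for a finite set
`R` of `(c,C)`-regular scales with `C 2^j < 2^{j'}` for `j < j'` in `R`, a site `q` with `‖q‖ > C 2^j` for all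
`j ∈ R`, and the smallest scale `j₀` of `R`: `S(q) ≤ 2^{-#R} S(2^{j₀} e_{i₀})`.
[cite: AizenmanDuminilCopinAnnals2021, arXiv:1912.07973 §6.2, (b2) (p. 24); Def. 5.11, P3 (p. 20)] -/
theorem le_of_regularChain (i₀ : Fin d) {c C : ℝ} (R : Finset ℕ)
    (hreg : ∀ j ∈ R, IsRegularScale S c C (2 ^ j))
    (hsep : ∀ j ∈ R, ∀ j' ∈ R, j < j' → C * 2 ^ j < (2 ^ j' : ℝ)) :
    ∀ q : Site d, (∀ j ∈ R, C * 2 ^ j < (Site.supNorm q : ℝ)) → ∀ j₀ ∈ R, (∀ j ∈ R, j₀ ≤ j) →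
      S q ≤ ((2 : ℝ) ^ #R)⁻¹ * S (Pi.single i₀ ((2 : ℤ) ^ j₀)) := by
  induction R using Finset.induction_on_max with
  | empty => intro q _ j₀ hj₀; simp at hj₀
  | insert a s has ih =>
    intro q hq j₀ hj₀ hmin
    have hanot : a ∉ s := fun h => lt_irrefl a (has a h)
    have hrega := hreg a (mem_insert_self a s)
    -- P3 at the scale `a`
    have h3 : S q ≤ S (Pi.single i₀ ((2 : ℤ) ^ a)) / 2 := by
      refine hrega.p3 _ (single_pow_mem_box i₀ a) q ?_
      have := hq a (mem_insert_self a s)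
      push_cast at this ⊢
      exact this
    rw [card_insert_of_notMem hanot]
    by_cases hs : s = ∅
    · subst hs
      have : j₀ = a := by simpa using hj₀
      subst this
      simp only [card_empty, zero_add, pow_one]
      linarith
    · -- the smallest scale is in `s`; induct with `q' = 2^a e`
      obtain ⟨x, hx⟩ := Finset.nonempty_iff_ne_empty.2 hs
      have hj₀s : j₀ ∈ s := by
        rcases mem_insert.1 hj₀ with h | h
        · exfalso
          have h1 := hmin x (mem_insert_of_mem hx)
          have h2 := has x hx
          omega
        · exact h
      have hq' : ∀ j ∈ s, C * 2 ^ j < (Site.supNorm (Pi.single i₀ ((2 : ℤ) ^ a) : Site d) : ℝ) := by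
        intro j hj
        rw [supNorm_single_pow]; push_cast
        exact hsep j (mem_insert_of_mem hj) a (mem_insert_self a s) (has j hj)
      have h := ih (fun j hj => hreg j (mem_insert_of_mem hj))
        (fun j hj j' hj' hjj' => hsep j (mem_insert_of_mem hj) j' (mem_insert_of_mem hj') hjj')
        (Pi.single i₀ ((2 : ℤ) ^ a)) hq' j₀ hj₀s (fun j hj => hmin j (mem_insert_of_mem hj))
      calc S q ≤ S (Pi.single i₀ ((2 : ℤ) ^ a)) / 2 := h3
        _ ≤ ((2 : ℝ) ^ #s)⁻¹ * S (Pi.single i₀ ((2 : ℤ) ^ j₀)) / 2 := by gcongr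
        _ = ((2 : ℝ) ^ (#s + 1))⁻¹ * S (Pi.single i₀ ((2 : ℤ) ^ j₀)) := by rw [pow_succ]; field_simp

/-! ### Elementary facts on scales and index sets -/

/-- The regular scales of `𝒦` in `[k, ℓ)`. [folklore] -/
def scalesBetween (𝒦 : Finset ℕ) (k ℓ : ℕ) : Finset ℕ := 𝒦.filter fun j => k ≤ j ∧ j < ℓ

/-- Membership in `scalesBetween`. [folklore] -/
theorem mem_scalesBetween {𝒦 : Finset ℕ} {k ℓ j : ℕ} : j ∈ scalesBetween 𝒦 k ℓ ↔ j ∈ 𝒦 ∧ k ≤ j ∧ j < ℓ := by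
  unfold scalesBetween; rw [mem_filter]

/-- `#(𝒦 ∩ [k,ℓ)) ≤ ℓ - k`. [folklore] -/
theorem card_scalesBetween_le (𝒦 : Finset ℕ) (k ℓ : ℕ) : #(scalesBetween 𝒦 k ℓ) ≤ ℓ - k := by
  calc #(scalesBetween 𝒦 k ℓ) ≤ #(Finset.Ico k ℓ) := by
        refine card_le_card fun j hj => ?_
        rw [mem_scalesBetween] at hj
        exact Finset.mem_Ico.2 ⟨hj.2.1, hj.2.2⟩
    _ = ℓ - k := Nat.card_Ico k ℓ

/-- For fixed `k`, `ℓ ↦ #(𝒦 ∩ [k,ℓ))` is injective on `{ℓ ∈ 𝒦 : k < ℓ}`. [folklore] -/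
theorem card_scalesBetween_injOn (𝒦 : Finset ℕ) (k : ℕ) :
    Set.InjOn (fun ℓ => #(scalesBetween 𝒦 k ℓ)) (𝒦.filter fun ℓ => k < ℓ : Finset ℕ) := by
  -- strictly monotone there
  have hmono : ∀ ℓ ∈ (𝒦.filter fun ℓ => k < ℓ), ∀ ℓ' ∈ (𝒦.filter fun ℓ => k < ℓ), ℓ < ℓ' →
      #(scalesBetween 𝒦 k ℓ) < #(scalesBetween 𝒦 k ℓ') := by
    intro ℓ hℓ ℓ' _ hlt
    rw [mem_filter] at hℓ
    refine card_lt_card ⟨fun j hj => ?_, fun hsub => ?_⟩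
    · rw [mem_scalesBetween] at hj ⊢
      exact ⟨hj.1, hj.2.1, hj.2.2.trans hlt⟩
    · have : ℓ ∈ scalesBetween 𝒦 k ℓ' := mem_scalesBetween.2 ⟨hℓ.1, hℓ.2.le, hlt⟩
      have := mem_scalesBetween.1 (hsub this)
      omega
  intro ℓ hℓ ℓ' hℓ' heq
  rcases lt_trichotomy ℓ ℓ' with h | h | h
  · exact absurd heq (hmono ℓ hℓ ℓ' hℓ' h).ne
  · exact h
  · exact absurd heq.symm (hmono ℓ' hℓ' ℓ hℓ h).ne

/-- **A sub-sum of the geometric series through an injection**: `∑_{ℓ ∈ T} 2^{-g(ℓ)} ≤ 2` when `g` is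
injective on `T`. [folklore] -/
theorem sum_inv_two_pow_le_two {ι : Type*} (T : Finset ι) (g : ι → ℕ) (hg : Set.InjOn g T) :
    ∑ ℓ ∈ T, ((2 : ℝ) ^ g ℓ)⁻¹ ≤ 2 := by
  classical
  rw [← Finset.sum_image (f := fun t => ((2 : ℝ) ^ t)⁻¹) hg]
  have h : ∀ t, ((2 : ℝ) ^ t)⁻¹ = (1 / 2 : ℝ) ^ t := fun t => by rw [one_div, inv_pow]
  simp_rw [h]
  calc ∑ t ∈ T.image g, (1 / 2 : ℝ) ^ t ≤ ∑' t, (1 / 2 : ℝ) ^ t :=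
        Summable.sum_le_tsum _ (fun _ _ => by positivity) summable_geometric_two
    _ = 2 := tsum_geometric_two

/-- Sites of `Ann(2^k, 2^{k+1})` have sup norm in `[2^k, 2^{k+1}]` and lie in the regular annulus
`Ann(2^k/2, 4·2^k)`. [folklore] -/
theorem mem_ann_regular_of_mem {k : ℕ} {u : Site d} (hu : u ∈ ann d (2 ^ k) (2 * 2 ^ k)) :
    u ∈ ann d (2 ^ k / 2) (4 * 2 ^ k) := by
  rw [mem_ann] at hu ⊢; omega

/-! ### (6.5), off-diagonal case `k < ℓ` -/

/-- **(6.5) for two different scales.** Let `S > 0`, `k < ℓ` two `(c,C)`-regular scales (`C ≥ 0`) of a set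
`𝒦` whose scales are separated (`(C+2)2^j < 2^{j'}` for `j < j'` in `𝒦`), `I_k ⊆ Ann(2^k,2^{k+1})`,
`I_ℓ ⊆ Ann(2^ℓ, 2^{ℓ+1})`, and suppose the domination inequalities `S(y) ≤ (1 + κ2^k/Y) S(y-u)` (`u ∈ I_k`),
`S(y) ≤ (1 + κ2^ℓ/Y) S(y-w)` (`w ∈ I_ℓ`) with `κ ≥ 0`, `2^ℓ ≤ Y`. Then
`∑_{v ∈ I_k, w ∈ I_ℓ} t(v,w) ≤ A(I_k) A(I_ℓ) (1 + C″ 2^{-r})`, `r = #(𝒦 ∩ [k,ℓ))`,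
`C″ = (1+κ)C + (2C + κ + 2Cκ)` — (b1): `S(y)/S(y-v) · S(w-v)/S(w) ≤ (1 + κ2^{k-ℓ})(1 + 2C2^{k-ℓ})` by P2 at
`ℓ`; (b2): `S(y)/S(y-w) · S(v-w)/S(v) ≤ (1+κ) · C 2^{-r}` by P3 along the scales between and P1 at `k`.
[cite: AizenmanDuminilCopinAnnals2021, arXiv:1912.07973 §6.2, proof of Prop. 6.6, case ℓ > k: (b0), (b1), (b2) (p. 24)] -/
theorem sum_twoSiteTerm_offDiag_le (hS : ∀ x, 0 < S x) (i₀ : Fin d) {c C κ Y : ℝ} (hC : 0 ≤ C) (hκ : 0 ≤ κ)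
    (𝒦 : Finset ℕ) (hreg : ∀ j ∈ 𝒦, IsRegularScale S c C (2 ^ j))
    (hsep : ∀ j ∈ 𝒦, ∀ j' ∈ 𝒦, j < j' → (C + 2) * 2 ^ j < (2 ^ j' : ℝ))
    {k ℓ : ℕ} (hk : k ∈ 𝒦) (hℓ : ℓ ∈ 𝒦) (hkℓ : k < ℓ) (hY : (2 ^ ℓ : ℝ) ≤ Y)
    (y : Site d) {Ik Iℓ : Finset (Site d)} (hIk : Ik ⊆ ann d (2 ^ k) (2 * 2 ^ k))
    (hIℓ : Iℓ ⊆ ann d (2 ^ ℓ) (2 * 2 ^ ℓ))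
    (hdomk : ∀ u ∈ Ik, S y ≤ (1 + κ * 2 ^ k / Y) * S (y - u))
    (hdomℓ : ∀ w ∈ Iℓ, S y ≤ (1 + κ * 2 ^ ℓ / Y) * S (y - w)) :
    ∑ v ∈ Ik, ∑ w ∈ Iℓ, twoSiteTerm S y v w ≤
      switchTotal S y Ik * switchTotal S y Iℓ *
        (1 + ((1 + κ) * C + (2 * C + κ + 2 * C * κ)) * ((2 : ℝ) ^ #(scalesBetween 𝒦 k ℓ))⁻¹) := by
  set r : ℕ := #(scalesBetween 𝒦 k ℓ) with hr
  have hY0 : 0 < Y := lt_of_lt_of_le (by positivity) hY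
  have h2k : (0 : ℝ) < 2 ^ k := by positivity
  have h2ℓ : (0 : ℝ) < 2 ^ ℓ := by positivity
  -- `2^{k-ℓ} ≤ 2^{-r}` and `2^k/Y ≤ 2^{k-ℓ}`
  have hkl2 : ℓ ≥ k + 2 := by
    have h := hsep k hk ℓ hℓ hkℓ
    by_contra hc
    push Not at hc
    have : ℓ = k + 1 := by omega
    subst this
    rw [pow_succ] at h
    nlinarith
  have hratio : (2 : ℝ) ^ k / 2 ^ ℓ ≤ ((2 : ℝ) ^ r)⁻¹ := by
    have hrle : r ≤ ℓ - k := card_scalesBetween_le 𝒦 k ℓ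
    rw [div_le_iff₀ h2ℓ, ← one_div, one_div_mul_eq_div, le_div_iff₀ (by positivity), ← pow_add]
    exact pow_le_pow_right₀ (by norm_num) (by omega)
  have hkY : (2 : ℝ) ^ k / Y ≤ ((2 : ℝ) ^ r)⁻¹ :=
    le_trans (div_le_div_of_nonneg_left h2k.le h2ℓ hY) hratio
  have hℓY : (2 : ℝ) ^ ℓ / Y ≤ 1 := by rw [div_le_one hY0]; exact hY
  have hr1 : ((2 : ℝ) ^ r)⁻¹ ≤ 1 := by
    rw [inv_le_one₀ (by positivity)]; exact one_le_pow₀ (by norm_num)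
  -- pointwise bound
  have hr0 : (0 : ℝ) ≤ ((2 : ℝ) ^ r)⁻¹ := by positivity
  have hpt : ∀ v ∈ Ik, ∀ w ∈ Iℓ, twoSiteTerm S y v w ≤ switchCoeff S y v * switchCoeff S y w *
      (1 + ((1 + κ) * C + (2 * C + κ + 2 * C * κ)) * ((2 : ℝ) ^ r)⁻¹) := by
    intro v hv w hw
    have hvann := hIk hv
    have hwann := hIℓ hw
    have hva := mem_ann_regular_of_mem hvann
    have hwa := mem_ann_regular_of_mem hwann
    rw [mem_ann] at hvann hwann
    have haa : 0 < switchCoeff S y v * switchCoeff S y w := mul_pos (switchCoeff_pos hS y v) (switchCoeff_pos hS y w)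
    -- (b2): `S(v-w) ≤ 2^{-r} C S(v)` and `S(y)/S(y-w) ≤ 1+κ`
    have hb2a : S (v - w) ≤ ((2 : ℝ) ^ r)⁻¹ * (C * S v) := by
      -- the chain of regular scales between `k` and `ℓ`
      have hR : ∀ j ∈ scalesBetween 𝒦 k ℓ, IsRegularScale S c C (2 ^ j) := fun j hj =>
        hreg j (mem_scalesBetween.1 hj).1
      have hRsep : ∀ j ∈ scalesBetween 𝒦 k ℓ, ∀ j' ∈ scalesBetween 𝒦 k ℓ, j < j' → C * 2 ^ j < (2 ^ j' : ℝ) := by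
        intro j hj j' hj' hjj'
        have h := hsep j (mem_scalesBetween.1 hj).1 j' (mem_scalesBetween.1 hj').1 hjj'
        nlinarith [pow_pos (show (0:ℝ) < 2 by norm_num) j]
      have hq : ∀ j ∈ scalesBetween 𝒦 k ℓ, C * 2 ^ j < (Site.supNorm (v - w) : ℝ) := by
        intro j hj
        obtain ⟨hj𝒦, hkj, hjℓ⟩ := mem_scalesBetween.1 hj
        have h := hsep j hj𝒦 ℓ hℓ hjℓ
        -- `‖v - w‖ ≥ ‖w‖ - ‖v‖ ≥ 2^ℓ - 2^{k+1}`
        have htri := Site.supNorm_le_supNorm_sub_add w v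
        rw [Site.supNorm_sub_comm] at htri
        have h1 : (2 ^ ℓ : ℝ) ≤ Site.supNorm (v - w) + 2 * 2 ^ k := by
          have : 2 ^ ℓ ≤ Site.supNorm (v - w) + 2 * 2 ^ k := by omega
          exact_mod_cast this
        have h2 : (2 : ℝ) ^ k ≤ 2 ^ j := pow_le_pow_right₀ (by norm_num) hkj
        nlinarith
      have hmin : ∀ j ∈ scalesBetween 𝒦 k ℓ, k ≤ j := fun j hj => (mem_scalesBetween.1 hj).2.1
      have hkR : k ∈ scalesBetween 𝒦 k ℓ := mem_scalesBetween.2 ⟨hk, le_rfl, hkℓ⟩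
      have hchain := le_of_regularChain i₀ (scalesBetween 𝒦 k ℓ) hR hRsep (v - w) hq k hkR hmin
      -- P1 at `k`: `S(2^k e) ≤ C S(v)`
      have hp1 : S (Pi.single i₀ ((2 : ℤ) ^ k)) ≤ C * S v := by
        refine (hreg k hk).p1 v hva _ ?_
        rw [mem_ann, supNorm_single_pow]; omega
      exact hchain.trans (mul_le_mul_of_nonneg_left hp1 (by positivity))
    have hb2 : S (v - w) * S y / (S v * S (y - w)) ≤ (1 + κ) * C * ((2 : ℝ) ^ r)⁻¹ := by
      rw [div_le_iff₀ (mul_pos (hS _) (hS _))]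
      have hyw : S y ≤ (1 + κ) * S (y - w) := by
        refine (hdomℓ w hw).trans (mul_le_mul_of_nonneg_right ?_ (hS _).le)
        have := mul_le_mul_of_nonneg_left hℓY hκ
        rw [mul_div_assoc]; linarith
      calc S (v - w) * S y ≤ (((2 : ℝ) ^ r)⁻¹ * (C * S v)) * ((1 + κ) * S (y - w)) :=
            mul_le_mul hb2a hyw (hS _).le (mul_nonneg hr0 (mul_nonneg hC (hS v).le))
        _ = (1 + κ) * C * ((2 : ℝ) ^ r)⁻¹ * (S v * S (y - w)) := by ring
    -- (b1): `S(w-v) ≤ (1 + 2C 2^{k-ℓ}) S(w)` (P2 at `ℓ`) and `S(y)/S(y-v) ≤ 1 + κ 2^{k-ℓ}`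
    have hb1a : S (w - v) ≤ (1 + 2 * C * ((2 : ℝ) ^ r)⁻¹) * S w := by
      have hwv : w - v ∈ ann d (2 ^ ℓ / 2) (4 * 2 ^ ℓ) := by
        refine sub_mem_ann_of_mem_ann (n := 2 ^ ℓ) (by rw [mem_ann]; omega) ?_
        calc 2 * Site.supNorm v ≤ 2 * (2 * 2 ^ k) := by omega
          _ = 2 ^ (k + 2) := by ring
          _ ≤ 2 ^ ℓ := Nat.pow_le_pow_right (by norm_num) hkl2
      have hp2 := (hreg ℓ hℓ).p2 w hwa (w - v) hwv
      have hdiff : w - (w - v) = v := by abel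
      rw [hdiff] at hp2
      have hwpos : (0 : ℝ) < Site.supNorm w := by
        have : 2 ^ ℓ ≤ Site.supNorm w := hwann.1
        have h' : (0:ℝ) < 2 ^ ℓ := by positivity
        exact_mod_cast lt_of_lt_of_le (by positivity : 0 < 2 ^ ℓ) this
      have hvw : (Site.supNorm v : ℝ) / Site.supNorm w ≤ 2 * ((2 : ℝ) ^ r)⁻¹ := by
        rw [div_le_iff₀ hwpos]
        have h1 : (Site.supNorm v : ℝ) ≤ 2 * 2 ^ k := by exact_mod_cast hvann.2
        have h2 : (2 ^ ℓ : ℝ) ≤ Site.supNorm w := by exact_mod_cast hwann.1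
        calc (Site.supNorm v : ℝ) ≤ 2 * 2 ^ k := h1
          _ = 2 * (2 ^ k / 2 ^ ℓ) * 2 ^ ℓ := by field_simp
          _ ≤ 2 * ((2 : ℝ) ^ r)⁻¹ * Site.supNorm w := by gcongr
      have h3 : S (w - v) ≤ S w + C * ((Site.supNorm v : ℝ) / Site.supNorm w) * S w := by
        have h' := hp2
        rw [abs_le] at h'
        linarith [h'.1]
      calc S (w - v) ≤ S w + C * ((Site.supNorm v : ℝ) / Site.supNorm w) * S w := h3
        _ ≤ S w + C * (2 * ((2 : ℝ) ^ r)⁻¹) * S w := by gcongr; exact (hS w).le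
        _ = (1 + 2 * C * ((2 : ℝ) ^ r)⁻¹) * S w := by ring
    have hb1 : S (w - v) * S y / (S w * S (y - v)) ≤ 1 + (2 * C + κ + 2 * C * κ) * ((2 : ℝ) ^ r)⁻¹ := by
      rw [div_le_iff₀ (mul_pos (hS _) (hS _))]
      have hyv : S y ≤ (1 + κ * ((2 : ℝ) ^ r)⁻¹) * S (y - v) := by
        refine (hdomk v hv).trans (mul_le_mul_of_nonneg_right ?_ (hS _).le)
        have := mul_le_mul_of_nonneg_left hkY hκ
        rw [mul_div_assoc]; linarith
      calc S (w - v) * S y ≤ ((1 + 2 * C * ((2 : ℝ) ^ r)⁻¹) * S w) * ((1 + κ * ((2 : ℝ) ^ r)⁻¹) * S (y - v)) :=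
            mul_le_mul hb1a hyv (hS _).le
              (mul_nonneg (add_nonneg zero_le_one (mul_nonneg (mul_nonneg (by norm_num) hC) hr0)) (hS w).le)
        _ = (1 + (2 * C + κ) * ((2 : ℝ) ^ r)⁻¹ + 2 * C * κ * (((2 : ℝ) ^ r)⁻¹ * ((2 : ℝ) ^ r)⁻¹)) *
              (S w * S (y - v)) := by ring
        _ ≤ (1 + (2 * C + κ) * ((2 : ℝ) ^ r)⁻¹ + 2 * C * κ * (((2 : ℝ) ^ r)⁻¹ * 1)) * (S w * S (y - v)) := by
            gcongr
            · exact (mul_pos (hS _) (hS _)).le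
        _ = (1 + (2 * C + κ + 2 * C * κ) * ((2 : ℝ) ^ r)⁻¹) * (S w * S (y - v)) := by ring
    rw [twoSiteTerm_eq hS]
    calc switchCoeff S y v * switchCoeff S y w * (S (v - w) * S y / (S v * S (y - w))) +
          switchCoeff S y v * switchCoeff S y w * (S (w - v) * S y / (S w * S (y - v)))
        ≤ switchCoeff S y v * switchCoeff S y w * ((1 + κ) * C * ((2 : ℝ) ^ r)⁻¹) +
          switchCoeff S y v * switchCoeff S y w * (1 + (2 * C + κ + 2 * C * κ) * ((2 : ℝ) ^ r)⁻¹) := by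
          gcongr
      _ = _ := by ring
  -- sum
  calc ∑ v ∈ Ik, ∑ w ∈ Iℓ, twoSiteTerm S y v w
      ≤ ∑ v ∈ Ik, ∑ w ∈ Iℓ, switchCoeff S y v * switchCoeff S y w *
          (1 + ((1 + κ) * C + (2 * C + κ + 2 * C * κ)) * ((2 : ℝ) ^ r)⁻¹) :=
        Finset.sum_le_sum fun v hv => Finset.sum_le_sum fun w hw => hpt v hv w hw
    _ = _ := by
        unfold switchTotal
        rw [Finset.sum_mul_sum, Finset.sum_mul]
        refine Finset.sum_congr rfl fun v _ => ?_
        rw [Finset.sum_mul]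

/-- For fixed `k`, `ℓ ↦ #(𝒦 ∩ [ℓ,k))` is injective on `{ℓ ∈ 𝒦 : ℓ < k}`. [folklore] -/
theorem card_scalesBetween_injOn_left (𝒦 : Finset ℕ) (k : ℕ) :
    Set.InjOn (fun ℓ => #(scalesBetween 𝒦 ℓ k)) (𝒦.filter fun ℓ => ℓ < k : Finset ℕ) := by
  have hmono : ∀ ℓ ∈ (𝒦.filter fun ℓ => ℓ < k), ∀ ℓ' ∈ (𝒦.filter fun ℓ => ℓ < k), ℓ < ℓ' →
      #(scalesBetween 𝒦 ℓ' k) < #(scalesBetween 𝒦 ℓ k) := by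
    intro ℓ hℓ ℓ' _ hlt
    rw [mem_filter] at hℓ
    refine card_lt_card ⟨fun j hj => ?_, fun hsub => ?_⟩
    · rw [mem_scalesBetween] at hj ⊢
      exact ⟨hj.1, hlt.le.trans hj.2.1, hj.2.2⟩
    · have : ℓ ∈ scalesBetween 𝒦 ℓ k := mem_scalesBetween.2 ⟨hℓ.1, le_rfl, hℓ.2⟩
      have := mem_scalesBetween.1 (hsub this)
      omega
  intro ℓ hℓ ℓ' hℓ' heq
  rcases lt_trichotomy ℓ ℓ' with h | h | h
  · exact absurd heq.symm (hmono ℓ hℓ ℓ' hℓ' h).ne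
  · exact h
  · exact absurd heq (hmono ℓ' hℓ' ℓ hℓ h).ne

/-! ### (6.5), diagonal case `k = ℓ` -/

/-- **A shell of the regular annulus carries at most `#Λ · C S(u₀)`**: for `Ann(2^k/2, 4·2^k)` `(c,C)`-regular,
`u₀` in it and radii `2^k/2 ≤ a+1`, `b ≤ 4·2^k`: `∑_{p ∈ Λ_b ∖ Λ_a} S(p) ≤ #Λ_b · C S(u₀)` (P1). [cite: AizenmanDuminilCopinAnnals2021, arXiv:1912.07973 Def. 5.11, P1 (p. 20)] -/
theorem sum_sdiff_box_le_card_mul {c C : ℝ} {k : ℕ} (hreg : IsRegularScale S c C (2 ^ k)) (hC : 0 ≤ C)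
    {u₀ : Site d} (hu₀ : u₀ ∈ ann d (2 ^ k / 2) (4 * 2 ^ k)) (hS0 : 0 ≤ S u₀) {a b : ℕ}
    (ha : 2 ^ k / 2 ≤ a + 1) (hb : b ≤ 4 * 2 ^ k) :
    ∑ p ∈ box d b \ box d a, S p ≤ #(box d b) * (C * S u₀) := by
  calc ∑ p ∈ box d b \ box d a, S p ≤ ∑ p ∈ box d b \ box d a, C * S u₀ := by
        refine Finset.sum_le_sum fun p hp => hreg.p1 u₀ hu₀ p ?_
        rw [Finset.mem_sdiff, mem_box_iff_supNorm_le, mem_box_iff_supNorm_le] at hp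
        rw [mem_ann]; omega
    _ = #(box d b \ box d a) * (C * S u₀) := by rw [Finset.sum_const, nsmul_eq_mul]
    _ ≤ #(box d b) * (C * S u₀) := by
        refine mul_le_mul_of_nonneg_right ?_ (mul_nonneg hC hS0)
        exact_mod_cast card_le_card sdiff_subset

/-- **(6.5) on the diagonal.** Let `S > 0`, `k` a `(c,C)`-regular scale (`c > 0`, `C ≥ 0`),
`I ⊆ Ann(2^k, 2^{k+1})` with `#I ≥ γ 2^{dk}` (`γ > 0`) and the domination `S(y) ≤ (1 + κ2^k/Y)S(y-u)` on `I`
(`κ ≥ 0`, `2^k ≤ Y`). Then `∑_{v,w ∈ I} t(v,w) ≤ C_Δ A(I)²` with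
`C_Δ = 2C · (1 + (1+c)/c) 9^d C²(1+κ)/γ`: by P1, `∑_w S(w)S(v-w) ≤ C S(v) χ_{2^{k+2}}`; by P4 and P1,
`χ_{2^{k+2}} ≤ (1 + (1+c)/c) #Λ_{2^{k+2}} C S(u₀)`; and `A(I) ≥ #I S(u₀)/(C(1+κ))` ("where the first
inequality is trivial, the second one is true by Property P4, … and the fourth inequality follows from
Property P1"). [cite: AizenmanDuminilCopinAnnals2021, arXiv:1912.07973 §6.2, proof of Prop. 6.6, case ℓ = k, (aaas)–(6.7) (p. 24)] -/
theorem sum_twoSiteTerm_diag_le (hS : ∀ x, 0 < S x) {c C κ Y γ : ℝ} (hc : 0 < c) (hC : 0 ≤ C) (hκ : 0 ≤ κ)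
    (hγ : 0 < γ) {k : ℕ} (hreg : IsRegularScale S c C (2 ^ k)) (hY : (2 ^ k : ℝ) ≤ Y)
    (y : Site d) {I : Finset (Site d)} (hI : I ⊆ ann d (2 ^ k) (2 * 2 ^ k))
    (hcard : γ * (2 ^ k : ℝ) ^ d ≤ #I) (hdom : ∀ u ∈ I, S y ≤ (1 + κ * 2 ^ k / Y) * S (y - u)) :
    ∑ v ∈ I, ∑ w ∈ I, twoSiteTerm S y v w ≤
      (2 * C * ((1 + (1 + c) / c) * 9 ^ d * C ^ 2 * (1 + κ) / γ)) * switchTotal S y I ^ 2 := by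
  have hY0 : 0 < Y := lt_of_lt_of_le (by positivity) hY
  have hkY : κ * 2 ^ k / Y ≤ κ := by
    have h1 : (2 : ℝ) ^ k / Y ≤ 1 := by rw [div_le_one hY0]; exact hY
    have := mul_le_mul_of_nonneg_left h1 hκ
    rw [mul_div_assoc]; linarith
  -- a reference point of `I`
  have hIne : I.Nonempty := by
    rw [← Finset.card_pos]
    have : (0 : ℝ) < #I := lt_of_lt_of_le (by positivity) hcard
    exact_mod_cast this
  obtain ⟨u₀, hu₀⟩ := hIne
  have hu₀a := mem_ann_regular_of_mem (hI hu₀)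
  -- P1 around `u₀`
  have hP1up : ∀ p ∈ ann d (2 ^ k / 2) (4 * 2 ^ k), S p ≤ C * S u₀ := fun p hp => hreg.p1 u₀ hu₀a p hp
  have hP1dn : ∀ p ∈ ann d (2 ^ k / 2) (4 * 2 ^ k), S u₀ ≤ C * S p := fun p hp => hreg.p1 p hp u₀ hu₀a
  -- the susceptibility `χ₂ = ∑_{Λ_{2^{k+2}}} S`
  set χ₂ : ℝ := ∑ p ∈ box d (4 * 2 ^ k), S p with hχ₂
  have hχ₂ : χ₂ ≤ (1 + (1 + c) / c) * #(box d (4 * 2 ^ k)) * (C * S u₀) := by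
    -- `χ(2^{k+1}) ≤ ((1+c)/c)(χ(2^{k+1}) - χ(2^k))`
    have hp4 := hreg.p4
    rw [boxSusceptibility_natCast, boxSusceptibility_natCast] at hp4
    set X : ℝ := ∑ p ∈ box d (2 * 2 ^ k), S p with hX
    set Z : ℝ := ∑ p ∈ box d (2 ^ k), S p with hZ
    have hXZ : X - Z = ∑ p ∈ box d (2 * 2 ^ k) \ box d (2 ^ k), S p := by
      rw [hX, hZ, ← Finset.sum_sdiff (box_mono d (show 2 ^ k ≤ 2 * 2 ^ k by omega)), add_sub_cancel_right]
    have hshell1 : X - Z ≤ #(box d (2 * 2 ^ k)) * (C * S u₀) := by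
      rw [hXZ]
      exact sum_sdiff_box_le_card_mul hreg hC hu₀a (hS u₀).le (by have := Nat.div_le_self (2 ^ k) 2; omega)
        (by omega)
    have hX0 : 0 ≤ X := Finset.sum_nonneg fun p _ => (hS p).le
    have hXle : X ≤ (1 + c) / c * (X - Z) := by
      rw [div_mul_eq_mul_div, le_div_iff₀ hc]
      nlinarith
    have hshell2 : χ₂ - X ≤ #(box d (4 * 2 ^ k)) * (C * S u₀) := by
      have : χ₂ - X = ∑ p ∈ box d (4 * 2 ^ k) \ box d (2 * 2 ^ k), S p := by
        rw [hχ₂, hX, ← Finset.sum_sdiff (box_mono d (show 2 * 2 ^ k ≤ 4 * 2 ^ k by omega)), add_sub_cancel_right]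
      rw [this]
      exact sum_sdiff_box_le_card_mul hreg hC hu₀a (hS u₀).le (by have := Nat.div_le_self (2 ^ k) 2; omega) le_rfl
    have hcardle : (#(box d (2 * 2 ^ k)) : ℝ) ≤ #(box d (4 * 2 ^ k)) := by
      exact_mod_cast card_le_card (box_mono d (show 2 * 2 ^ k ≤ 4 * 2 ^ k by omega))
    have hCS : 0 ≤ C * S u₀ := mul_nonneg hC (hS u₀).le
    have hcc : 0 ≤ (1 + c) / c := by positivity
    calc χ₂ = X + (χ₂ - X) := by ring
      _ ≤ (1 + c) / c * (X - Z) + #(box d (4 * 2 ^ k)) * (C * S u₀) := add_le_add hXle hshell2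
      _ ≤ (1 + c) / c * (#(box d (4 * 2 ^ k)) * (C * S u₀)) + #(box d (4 * 2 ^ k)) * (C * S u₀) := by
          gcongr; exact hshell1.trans (mul_le_mul_of_nonneg_right hcardle hCS)
      _ = (1 + (1 + c) / c) * #(box d (4 * 2 ^ k)) * (C * S u₀) := by ring
  -- `#Λ_{2^{k+2}} ≤ 9^d 2^{dk}`
  have hcardbox : (#(box d (4 * 2 ^ k)) : ℝ) ≤ 9 ^ d * (2 ^ k : ℝ) ^ d := by
    rw [card_box]
    have : (2 * (4 * 2 ^ k) + 1 : ℕ) ^ d ≤ (9 * 2 ^ k) ^ d :=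
      Nat.pow_le_pow_left (by have := Nat.one_le_two_pow (n := k); omega) d
    calc ((2 * (4 * 2 ^ k) + 1 : ℕ) ^ d : ℕ) ≤ (((9 * 2 ^ k) ^ d : ℕ) : ℝ) := by exact_mod_cast this
      _ = 9 ^ d * (2 ^ k : ℝ) ^ d := by push_cast; ring
  -- `A(I) ≥ #I S(u₀)/(C(1+κ))`, i.e. `S(u₀) ≤ C(1+κ) A / #I`
  have hApos : 0 < switchTotal S y I := Finset.sum_pos (fun u _ => switchCoeff_pos hS y u) ⟨u₀, hu₀⟩
  have hAlow : (#I : ℝ) * S u₀ ≤ C * (1 + κ) * switchTotal S y I := by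
    have hterm : ∀ u ∈ I, S u₀ ≤ C * (1 + κ) * switchCoeff S y u := by
      intro u hu
      have h1 : S u₀ ≤ C * S u := hP1dn u (mem_ann_regular_of_mem (hI hu))
      have h2 : S y ≤ (1 + κ) * S (y - u) :=
        (hdom u hu).trans (mul_le_mul_of_nonneg_right (by linarith) (hS _).le)
      unfold switchCoeff
      rw [mul_div_assoc', le_div_iff₀ (hS y)]
      calc S u₀ * S y ≤ (C * S u) * ((1 + κ) * S (y - u)) := mul_le_mul h1 h2 (hS y).le (mul_nonneg hC (hS u).le)
        _ = C * (1 + κ) * (S u * S (y - u)) := by ring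
    calc (#I : ℝ) * S u₀ = ∑ u ∈ I, S u₀ := by rw [Finset.sum_const, nsmul_eq_mul]
      _ ≤ ∑ u ∈ I, C * (1 + κ) * switchCoeff S y u := Finset.sum_le_sum hterm
      _ = C * (1 + κ) * switchTotal S y I := by unfold switchTotal; rw [Finset.mul_sum]
  -- hence `χ₂ ≤ C₃ A`
  have hχA : χ₂ ≤ ((1 + (1 + c) / c) * 9 ^ d * C ^ 2 * (1 + κ) / γ) * switchTotal S y I := by
    have hcardpos : (0 : ℝ) < #I := lt_of_lt_of_le (by positivity) hcard
    have hSu₀ : S u₀ ≤ C * (1 + κ) * switchTotal S y I / #I := by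
      rw [le_div_iff₀ hcardpos]; linarith
    have h2kd : (0 : ℝ) < (2 ^ k : ℝ) ^ d := by positivity
    have hinv : (1 : ℝ) / #I ≤ 1 / (γ * (2 ^ k : ℝ) ^ d) := one_div_le_one_div_of_le (by positivity) hcard
    have hcc : 0 ≤ 1 + (1 + c) / c := by positivity
    calc χ₂ ≤ (1 + (1 + c) / c) * #(box d (4 * 2 ^ k)) * (C * S u₀) := hχ₂
      _ ≤ (1 + (1 + c) / c) * (9 ^ d * (2 ^ k : ℝ) ^ d) * (C * (C * (1 + κ) * switchTotal S y I / #I)) := by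
          gcongr
          · exact mul_nonneg hC (hS u₀).le
      _ = (1 + (1 + c) / c) * 9 ^ d * C ^ 2 * (1 + κ) * switchTotal S y I * ((2 ^ k : ℝ) ^ d * (1 / #I)) := by
          ring
      _ ≤ (1 + (1 + c) / c) * 9 ^ d * C ^ 2 * (1 + κ) * switchTotal S y I * ((2 ^ k : ℝ) ^ d * (1 / (γ * (2 ^ k : ℝ) ^ d))) := by
          gcongr
      _ = ((1 + (1 + c) / c) * 9 ^ d * C ^ 2 * (1 + κ) / γ) * switchTotal S y I := by
          field_simp
  -- the sum `U₁ = ∑_{v,w} S(w)S(v-w)S(y-v)/S(y) ≤ C χ₂ A`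
  have hU : ∑ v ∈ I, ∑ w ∈ I, S w * S (v - w) * S (y - v) / S y ≤ C * χ₂ * switchTotal S y I := by
    have hinner : ∀ v ∈ I, ∑ w ∈ I, S w * S (v - w) ≤ C * S v * χ₂ := by
      intro v hv
      have hva := mem_ann_regular_of_mem (hI hv)
      calc ∑ w ∈ I, S w * S (v - w) ≤ ∑ w ∈ I, C * S v * S (v - w) := by
            refine Finset.sum_le_sum fun w hw => mul_le_mul_of_nonneg_right ?_ (hS _).le
            exact hreg.p1 v hva w (mem_ann_regular_of_mem (hI hw))
        _ = C * S v * ∑ w ∈ I, S (v - w) := by rw [Finset.mul_sum]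
        _ ≤ C * S v * χ₂ := by
            refine mul_le_mul_of_nonneg_left ?_ (mul_nonneg hC (hS v).le)
            -- re-index `w ↦ v - w` into `Λ_{2^{k+2}}`
            rw [← Finset.sum_image (f := S) (s := I) (g := fun w => v - w) (fun a _ b _ h => sub_right_injective h)]
            refine Finset.sum_le_sum_of_subset_of_nonneg (fun p hp => ?_) (fun p _ _ => (hS p).le)
            rw [Finset.mem_image] at hp
            obtain ⟨w, hw, rfl⟩ := hp
            have hvn := hI hv; have hwn := hI hw
            rw [mem_ann] at hvn hwn
            rw [mem_box_iff_supNorm_le]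
            have h1 := Site.supNorm_add_le v (-w)
            rw [← sub_eq_add_neg, Site.supNorm_neg] at h1
            omega
    calc ∑ v ∈ I, ∑ w ∈ I, S w * S (v - w) * S (y - v) / S y
        = ∑ v ∈ I, (S (y - v) / S y) * ∑ w ∈ I, S w * S (v - w) := by
          refine Finset.sum_congr rfl fun v _ => ?_
          rw [Finset.mul_sum]
          refine Finset.sum_congr rfl fun w _ => ?_
          ring
      _ ≤ ∑ v ∈ I, (S (y - v) / S y) * (C * S v * χ₂) :=
          Finset.sum_le_sum fun v hv => mul_le_mul_of_nonneg_left (hinner v hv) (div_pos (hS _) (hS _)).le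
      _ = C * χ₂ * switchTotal S y I := by
          unfold switchTotal switchCoeff
          rw [Finset.mul_sum]
          refine Finset.sum_congr rfl fun v _ => ?_
          ring
  -- assemble: the two halves of `t` have the same sum
  have hsplit : ∑ v ∈ I, ∑ w ∈ I, twoSiteTerm S y v w =
      ∑ v ∈ I, ∑ w ∈ I, S w * S (v - w) * S (y - v) / S y + ∑ v ∈ I, ∑ w ∈ I, S w * S (v - w) * S (y - v) / S y := by
    have h1 : ∑ v ∈ I, ∑ w ∈ I, twoSiteTerm S y v w =
        ∑ v ∈ I, ∑ w ∈ I, (S w * S (v - w) * S (y - v) / S y + S v * S (w - v) * S (y - w) / S y) := by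
      refine Finset.sum_congr rfl fun v _ => Finset.sum_congr rfl fun w _ => ?_
      unfold twoSiteTerm; ring
    rw [h1]
    simp_rw [Finset.sum_add_distrib]
    congr 1
    rw [Finset.sum_comm]
  rw [hsplit]
  have hCχ : C * χ₂ * switchTotal S y I ≤ C * (((1 + (1 + c) / c) * 9 ^ d * C ^ 2 * (1 + κ) / γ) * switchTotal S y I) *
      switchTotal S y I := by
    refine mul_le_mul_of_nonneg_right (mul_le_mul_of_nonneg_left hχA hC) hApos.le
  nlinarith [hU, hCχ]

/-! ### The normalised double sum -/

/-- **"`E^{xy,∅}[𝐍ᵢ²] ≤ 1 + C₂/|𝒦|`" in un-normalised form.** Under the hypotheses of the two previous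
theorems for every scale of `𝒦` (positivity, regular separated scales, index sets in the annuli with
`#I_k ≥ γ2^{dk}`, domination with `2^k ≤ Y` on `𝒦`):
`∑_{k,ℓ ∈ 𝒦} (A_kA_ℓ)⁻¹ ∑_{v ∈ I_k, w ∈ I_ℓ} t(v,w) ≤ |𝒦|² + (C_Δ + 4C″)|𝒦|`.
[cite: AizenmanDuminilCopinAnnals2021, arXiv:1912.07973 §6.2, proof of Prop. 6.6, (6.4)–(6.5) (pp. 23–24)] -/
theorem sum_inv_mul_sum_twoSiteTerm_le (hS : ∀ x, 0 < S x) (i₀ : Fin d) {c C κ Y γ : ℝ} (hc : 0 < c)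
    (hC : 0 ≤ C) (hκ : 0 ≤ κ) (hγ : 0 < γ) (𝒦 : Finset ℕ) (hreg : ∀ j ∈ 𝒦, IsRegularScale S c C (2 ^ j))
    (hsep : ∀ j ∈ 𝒦, ∀ j' ∈ 𝒦, j < j' → (C + 2) * 2 ^ j < (2 ^ j' : ℝ))
    (hY : ∀ j ∈ 𝒦, (2 ^ j : ℝ) ≤ Y) (y : Site d) (I : ℕ → Finset (Site d))
    (hI : ∀ j ∈ 𝒦, I j ⊆ ann d (2 ^ j) (2 * 2 ^ j)) (hcard : ∀ j ∈ 𝒦, γ * (2 ^ j : ℝ) ^ d ≤ #(I j))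
    (hdom : ∀ j ∈ 𝒦, ∀ u ∈ I j, S y ≤ (1 + κ * 2 ^ j / Y) * S (y - u)) :
    ∑ k ∈ 𝒦, ∑ ℓ ∈ 𝒦, (switchTotal S y (I k) * switchTotal S y (I ℓ))⁻¹ *
        ∑ v ∈ I k, ∑ w ∈ I ℓ, twoSiteTerm S y v w ≤
      (#𝒦 : ℝ) ^ 2 + ((2 * C * ((1 + (1 + c) / c) * 9 ^ d * C ^ 2 * (1 + κ) / γ)) +
        4 * ((1 + κ) * C + (2 * C + κ + 2 * C * κ))) * #𝒦 := by
  set CΔ : ℝ := 2 * C * ((1 + (1 + c) / c) * 9 ^ d * C ^ 2 * (1 + κ) / γ) with hCΔ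
  set C'' : ℝ := (1 + κ) * C + (2 * C + κ + 2 * C * κ) with hC''
  have hC''0 : 0 ≤ C'' := by rw [hC'']; positivity
  have hApos : ∀ j ∈ 𝒦, 0 < switchTotal S y (I j) := by
    intro j hj
    have hIne : (I j).Nonempty := by
      rw [← Finset.card_pos]
      have : (0 : ℝ) < #(I j) := lt_of_lt_of_le (by positivity) (hcard j hj)
      exact_mod_cast this
    exact Finset.sum_pos (fun u _ => switchCoeff_pos hS y u) hIne
  -- the bound for one row `k`
  have hrow : ∀ k ∈ 𝒦, ∑ ℓ ∈ 𝒦, (switchTotal S y (I k) * switchTotal S y (I ℓ))⁻¹ *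
      ∑ v ∈ I k, ∑ w ∈ I ℓ, twoSiteTerm S y v w ≤ #𝒦 + (CΔ + 4 * C'') := by
    intro k hk
    -- pointwise in `ℓ`
    have hpt : ∀ ℓ ∈ 𝒦, (switchTotal S y (I k) * switchTotal S y (I ℓ))⁻¹ * ∑ v ∈ I k, ∑ w ∈ I ℓ, twoSiteTerm S y v w ≤
        1 + CΔ * (if ℓ = k then 1 else 0) +
          C'' * ((if k < ℓ then ((2 : ℝ) ^ #(scalesBetween 𝒦 k ℓ))⁻¹ else 0) +
            (if ℓ < k then ((2 : ℝ) ^ #(scalesBetween 𝒦 ℓ k))⁻¹ else 0)) := by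
      intro ℓ hℓ
      have hAk := hApos k hk
      have hAℓ := hApos ℓ hℓ
      rw [inv_mul_le_iff₀ (mul_pos hAk hAℓ)]
      rcases lt_trichotomy k ℓ with hkl | rfl | hlk
      · rw [if_neg hkl.ne', if_pos hkl, if_neg (not_lt.2 hkl.le)]
        have h := sum_twoSiteTerm_offDiag_le hS i₀ hC hκ 𝒦 hreg hsep hk hℓ hkl (hY ℓ hℓ) y (hI k hk) (hI ℓ hℓ)
          (hdom k hk) (hdom ℓ hℓ)
        refine h.trans (le_of_eq ?_)
        rw [← hC'']; ring
      · rw [if_pos rfl, if_neg (lt_irrefl k)]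
        have h := sum_twoSiteTerm_diag_le hS hc hC hκ hγ (hreg k hk) (hY k hk) y (hI k hk) (hcard k hk) (hdom k hk)
        refine h.trans ?_
        rw [← hCΔ, sq]
        nlinarith [mul_pos hAk hAk, hCΔ]
      · rw [if_neg hlk.ne, if_neg (not_lt.2 hlk.le), if_pos hlk]
        have h := sum_twoSiteTerm_offDiag_le hS i₀ hC hκ 𝒦 hreg hsep hℓ hk hlk (hY k hk) y (hI ℓ hℓ) (hI k hk)
          (hdom ℓ hℓ) (hdom k hk)
        have hsymm : ∑ v ∈ I k, ∑ w ∈ I ℓ, twoSiteTerm S y v w = ∑ w ∈ I ℓ, ∑ v ∈ I k, twoSiteTerm S y w v := by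
          rw [Finset.sum_comm]
          exact Finset.sum_congr rfl fun w _ => Finset.sum_congr rfl fun v _ => twoSiteTerm_comm S y v w
        rw [hsymm]
        refine h.trans (le_of_eq ?_)
        rw [← hC'']; ring
    refine (Finset.sum_le_sum hpt).trans ?_
    rw [Finset.sum_add_distrib, Finset.sum_add_distrib, Finset.sum_const, nsmul_eq_mul, mul_one,
      ← Finset.mul_sum, ← Finset.mul_sum, Finset.sum_ite_eq' 𝒦 k, if_pos hk, mul_one, Finset.sum_add_distrib,
      ← Finset.sum_filter, ← Finset.sum_filter]
    have h1 := sum_inv_two_pow_le_two (𝒦.filter fun ℓ => k < ℓ) (fun ℓ => #(scalesBetween 𝒦 k ℓ))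
      (card_scalesBetween_injOn 𝒦 k)
    have h2 := sum_inv_two_pow_le_two (𝒦.filter fun ℓ => ℓ < k) (fun ℓ => #(scalesBetween 𝒦 ℓ k))
      (card_scalesBetween_injOn_left 𝒦 k)
    nlinarith
  calc ∑ k ∈ 𝒦, ∑ ℓ ∈ 𝒦, (switchTotal S y (I k) * switchTotal S y (I ℓ))⁻¹ * ∑ v ∈ I k, ∑ w ∈ I ℓ, twoSiteTerm S y v w
      ≤ ∑ k ∈ 𝒦, ((#𝒦 : ℝ) + (CΔ + 4 * C'')) := Finset.sum_le_sum hrow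
    _ = (#𝒦 : ℝ) ^ 2 + (CΔ + 4 * C'') * #𝒦 := by rw [Finset.sum_const, nsmul_eq_mul]; ring

end Literature.Probability.LatticeModels
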